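import Mathlib.Algebra.Order.Chebyshev
import Mathlib.Algebra.BigOperators.Field
import Mathlib.Analysis.SpecialFunctions.Pow.Real
import Mathlib.Data.Matrix.Basic
import HarnessLib

/-!
# Sampling-and-query (SQ) access and oversampling: the input model of quantum-inspired algorithms

Chia, Gilyén, Li, Lin, Tang, Wang, *Sampling-based sublinear low-rank matrix arithmetic framework
for dequantizing quantum machine learning*, J. ACM 69(5):33 (2022) = arXiv:1910.06151, **§2.2
"Sampling and query access oracles"**, Definitions 2.5–2.9 and the two unnumbered lemmas of that
subsection (rejection sampling from an oversampled distribution; linear combinations =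
Tang, STOC 2019, Prop. 4.3). This is the classical INPUT MODEL against which "dequantization"
statements are typed (Tang 2019: "any state preparation assumptions in the quantum machine
learning model should be matched with ℓ²-norm sampling assumptions in the classical machine
learning model", quoted in Grønlund–Larsen arXiv:2411.02087 p. 2, whose Definitions 1–3 are the
same objects).

What is formalized (the MATHEMATICAL content of the access model; running times / oracle costs
`q(v), s(v), n(v)` are bookkeeping and are deliberately not modelled here):

* `normSq v = ‖v‖²` and the length-square ("importance sampling") distribution
  `lengthSqDist v i = v i² / ‖v‖²` of Def. 2.6 (`𝒟_v`), with `∑ i, lengthSqDist v i = 1` for `v ≠ 0`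
  (`sum_lengthSqDist`);
* Def. 2.7, `IsOversampledDist φ v p`: `p` is a probability vector with `p i ≥ 𝒟_v(i)/φ`; proved:
  `𝒟_v` itself is `1`-oversampled (`isOversampledDist_self`), `φ ≥ 1` is forced (`IsOversampledDist.one_le`),
  monotonicity in `φ`, and the rejection-sampling identity behind "we can convert a sample from `p` to a
  sample from `𝒟_v` with probability `1/φ`": the accepted mass at `i` is `𝒟_v(i)/φ`
  (`IsOversampledDist.acceptMass_eq`) and the total acceptance probability is `1/φ`
  (`IsOversampledDist.sum_acceptMass`);
* Def. 2.8, `OversamplingWitness φ v`: a vector `ṽ` with `‖ṽ‖² = φ‖v‖²` and `|ṽ i|² ≥ |v i|²`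
  ("`SQ_φ(v)` = `Q(v)` + `SQ(ṽ)`"); proved: `SQ₁(v) = SQ(v)` with `ṽ = v` (`OversamplingWitness.refl`),
  `φ ≥ 1` (`OversamplingWitness.one_le`), and `𝒟_ṽ` is a `φ`-oversampled distribution of `v`
  (`OversamplingWitness.isOversampledDist`);
* the linear-combination lemma (§2.2, "Linear combinations, Proposition 4.3 of [Tang 2019]"): from
  witnesses for `v₁,…,v_k` with factors `φ_t` and scalars `λ_t`, the vector
  `ṽ(i) = √(k ∑_t λ_t² ṽ_t(i)²)` is a witness for `∑_t λ_t v_t` with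
  `‖ṽ‖² = k ∑_t φ_t ‖λ_t v_t‖²`, i.e. `φ = k ∑_t φ_t‖λ_t v_t‖² / ‖∑_t λ_t v_t‖²`
  (`OversamplingWitness.linComb`, `normSq_linCombTilde`);
* Def. 2.9 (matrices): `frobSq A = ‖A‖_F²`, the row-norm distribution `rowDist A i = ‖A(i,·)‖²/‖A‖_F²`,
  and the remark after Def. 2.9 that sampling `i ∼ 𝒟_a` then `j ∼ 𝒟_{A(i,·)}` outputs `(i,j)` with
  probability `|A(i,j)|²/‖A‖_F²` (`rowDist_mul_lengthSqDist`);
* §2.2 Lemma "oversampling", first statement (sample from `𝒟_v` w.p. `≥ 1 − δ` in `O(φ log(1/δ))`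
  rounds): the weight of the `T`-round rejection transcripts in which every round rejects is
  `(1 − 1/φ)^T ≤ e^{−T/φ} ≤ δ` for `T ≥ φ ln(1/δ)` (`IsOversampledDist.allReject_weight`,
  `IsOversampledDist.allReject_weight_le`, section `rejectionRounds` at the end); its second
  statement (norm estimation) is `normSqEstimation` in `InnerProductEstimation.lean`.

Design choices. Vectors are `Fin n → ℝ` (the paper works over `ℂ` with `|v(i)|²`; every quantity
here depends on entries only through their squares, so the real case is the faithful special case
used by all the dequantized QML applications of §6; `-- TODO(general form): RCLike entries`).
Division junk values: for `v = 0`, `lengthSqDist v = 0` (not a distribution) — every lemma that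
needs a distribution assumes `v ≠ 0`, as the paper does implicitly (`‖v‖ ≠ 0`). No named facts are
introduced; everything stated is proved.

## References
* [ChiaEtAl2022] N.-H. Chia, A. Gilyén, T. Li, H.-H. Lin, E. Tang, C. Wang, J. ACM 69(5):33, 2022,
  doi:10.1145/3549524 (= STOC 2020; arXiv:1910.06151), §2.2 Defs. 2.5–2.9.
* [TangEwin2019] E. Tang, *A quantum-inspired classical algorithm for recommendation systems*,
  STOC 2019, 217–228, doi:10.1145/3313276.3316310, Prop. 4.3 (linear combinations).
* [GronlundLarsen2024] A. Grønlund, K. G. Larsen, arXiv:2411.02087v5, Defs. 1–3 (same model).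
-/

noncomputable section

namespace Literature.Computability.QuantumComplexity

namespace SampleQuery

open Finset

variable {n : ℕ}

/-! ### Squared norm and the length-square distribution (Def. 2.6) -/

/-- `‖v‖² = ∑ᵢ v(i)²`, the squared Euclidean norm of a real vector indexed by `Fin n`.
[cite: ChiaEtAl2022, §2.1 notation] -/
def normSq (v : Fin n → ℝ) : ℝ := ∑ i, v i ^ 2

/-- `‖v‖² ≥ 0`. [folklore] -/
theorem normSq_nonneg (v : Fin n → ℝ) : 0 ≤ normSq v :=
  sum_nonneg fun i _ => sq_nonneg (v i)

/-- `v(i)² ≤ ‖v‖²`. [folklore] -/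
theorem sq_le_normSq (v : Fin n → ℝ) (i : Fin n) : v i ^ 2 ≤ normSq v :=
  single_le_sum (f := fun j => v j ^ 2) (fun j _ => sq_nonneg (v j)) (mem_univ i)

/-- `‖v‖² = 0 ↔ v = 0`. [folklore] -/
theorem normSq_eq_zero_iff (v : Fin n → ℝ) : normSq v = 0 ↔ v = 0 := by
  constructor
  · intro h
    funext i
    have hi : v i ^ 2 = 0 := by
      have := (sum_eq_zero_iff_of_nonneg (fun j _ => sq_nonneg (v j))).1 h i (mem_univ i)
      simpa using this
    exact pow_eq_zero_iff (n := 2) (by norm_num) |>.1 hi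
  · rintro rfl
    simp [normSq]

/-- `‖v‖² > 0` for `v ≠ 0`. [folklore] -/
theorem normSq_pos {v : Fin n → ℝ} (hv : v ≠ 0) : 0 < normSq v :=
  lt_of_le_of_ne (normSq_nonneg v) (fun h => hv ((normSq_eq_zero_iff v).1 h.symm))

/-- `‖c v‖² = c² ‖v‖²`. [folklore] -/
theorem normSq_smul (c : ℝ) (v : Fin n → ℝ) : normSq (c • v) = c ^ 2 * normSq v := by
  simp only [normSq, Pi.smul_apply, smul_eq_mul, mul_pow, mul_sum]

/-- The length-square (importance-sampling) distribution `𝒟_v(i) = |v(i)|²/‖v‖²` of a vector —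
the distribution of the samples in "sampling and query access `SQ(v)`".
Junk value: `𝒟_0 = 0`. [cite: ChiaEtAl2022, Def. 2.6] -/
def lengthSqDist (v : Fin n → ℝ) (i : Fin n) : ℝ := v i ^ 2 / normSq v

/-- `𝒟_v(i) ≥ 0`. [cite: ChiaEtAl2022, Def. 2.6] -/
theorem lengthSqDist_nonneg (v : Fin n → ℝ) (i : Fin n) : 0 ≤ lengthSqDist v i :=
  div_nonneg (sq_nonneg _) (normSq_nonneg v)

/-- `𝒟_v(i) ≤ 1`. [cite: ChiaEtAl2022, Def. 2.6] -/
theorem lengthSqDist_le_one (v : Fin n → ℝ) (i : Fin n) : lengthSqDist v i ≤ 1 := by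
  unfold lengthSqDist
  rcases eq_or_ne v 0 with rfl | hv
  · simp [normSq]
  · exact (div_le_one (normSq_pos hv)).2 (sq_le_normSq v i)

/-- `𝒟_v` is a probability vector when `v ≠ 0`. [cite: ChiaEtAl2022, Def. 2.6] -/
theorem sum_lengthSqDist {v : Fin n → ℝ} (hv : v ≠ 0) : ∑ i, lengthSqDist v i = 1 := by
  unfold lengthSqDist
  rw [← sum_div]
  exact div_self (normSq_pos hv).ne'

/-- `𝒟_{c v} = 𝒟_v` for `c ≠ 0` (sampling access is insensitive to global scaling). [folklore] -/
theorem lengthSqDist_smul {c : ℝ} (hc : c ≠ 0) (v : Fin n → ℝ) :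
    lengthSqDist (c • v) = lengthSqDist v := by
  funext i
  simp only [lengthSqDist, normSq_smul, Pi.smul_apply, smul_eq_mul, mul_pow]
  rcases eq_or_ne (normSq v) 0 with h | h
  · simp [h]
  · field_simp

/-! ### `φ`-oversampled importance sampling distributions (Def. 2.7) -/

/-- `p` is a `φ`-oversampled importance sampling distribution of `v`: `p` is a probability vector on
`[n]` and `p(i) ≥ 𝒟_v(i)/φ` for all `i`. [cite: ChiaEtAl2022, Def. 2.7] -/
def IsOversampledDist (φ : ℝ) (v : Fin n → ℝ) (p : Fin n → ℝ) : Prop :=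
  (∀ i, 0 ≤ p i) ∧ ∑ i, p i = 1 ∧ ∀ i, lengthSqDist v i / φ ≤ p i

/-- `𝒟_v` is a `1`-oversampled importance sampling distribution of `v` (`v ≠ 0`).
[cite: ChiaEtAl2022, Def. 2.7–2.8 ("`SQ₁(v)` is the same as `SQ(v)`")] -/
theorem isOversampledDist_self {v : Fin n → ℝ} (hv : v ≠ 0) :
    IsOversampledDist 1 v (lengthSqDist v) :=
  ⟨lengthSqDist_nonneg v, sum_lengthSqDist hv, fun i => by simp⟩

namespace IsOversampledDist

variable {φ : ℝ} {v p : Fin n → ℝ}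

/-- `p ≥ 0`. [cite: ChiaEtAl2022, Def. 2.7] -/
theorem nonneg (h : IsOversampledDist φ v p) (i : Fin n) : 0 ≤ p i := h.1 i

/-- `∑ p = 1`. [cite: ChiaEtAl2022, Def. 2.7] -/
theorem sum_eq_one (h : IsOversampledDist φ v p) : ∑ i, p i = 1 := h.2.1

/-- `𝒟_v(i)/φ ≤ p(i)`. [cite: ChiaEtAl2022, Def. 2.7] -/
theorem div_le (h : IsOversampledDist φ v p) (i : Fin n) : lengthSqDist v i / φ ≤ p i := h.2.2 i

/-- The oversampling factor of a genuine vector is at least `1` (summing `𝒟_v(i)/φ ≤ p(i)` over `i`).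
[cite: ChiaEtAl2022, Def. 2.7 ("for `φ ≥ 1`")] -/
theorem one_le (h : IsOversampledDist φ v p) (hv : v ≠ 0) (hφ : 0 < φ) : 1 ≤ φ := by
  have hsum : ∑ i, lengthSqDist v i / φ ≤ ∑ i, p i := sum_le_sum fun i _ => h.div_le i
  rw [← sum_div, sum_lengthSqDist hv, h.sum_eq_one] at hsum
  rwa [div_le_one hφ] at hsum

/-- Oversampling is monotone in the factor. [cite: ChiaEtAl2022, Def. 2.7] -/
theorem mono {φ' : ℝ} (h : IsOversampledDist φ v p) (hφ : 0 < φ) (hle : φ ≤ φ') :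
    IsOversampledDist φ' v p :=
  ⟨h.1, h.2.1, fun i =>
    (div_le_div_of_nonneg_left (lengthSqDist_nonneg v i) hφ hle).trans (h.div_le i)⟩

/-- Rejection sampling from an oversampled distribution: draw `i ∼ p`, accept with probability
`(𝒟_v(i)/p(i))/φ`. The accepted mass at `i`. [cite: ChiaEtAl2022, §2.2, text after Def. 2.7] -/
def acceptMass (φ : ℝ) (v p : Fin n → ℝ) (i : Fin n) : ℝ := p i * (lengthSqDist v i / p i / φ)

/-- The acceptance probability `(𝒟_v(i)/p(i))/φ` is a probability (`≤ 1`; it is `≥ 0` trivially).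
[cite: ChiaEtAl2022, §2.2, text after Def. 2.7] -/
theorem accept_le_one (h : IsOversampledDist φ v p) (hφ : 0 < φ) (i : Fin n) :
    lengthSqDist v i / p i / φ ≤ 1 := by
  rcases (h.nonneg i).eq_or_lt with hp | hp
  · simp [← hp]
  · rw [div_div, div_le_one (mul_pos hp hφ)]
    have := h.div_le i
    rwa [div_le_iff₀ hφ] at this

/-- The accepted mass at `i` equals `𝒟_v(i)/φ`, i.e. conditioned on acceptance the output is
distributed exactly as `𝒟_v`. [cite: ChiaEtAl2022, §2.2, text after Def. 2.7] -/
theorem acceptMass_eq (h : IsOversampledDist φ v p) (hφ : 0 < φ) (i : Fin n) :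
    acceptMass φ v p i = lengthSqDist v i / φ := by
  unfold acceptMass
  rcases (h.nonneg i).eq_or_lt with hp | hp
  · -- `p i = 0` forces `𝒟_v(i) = 0`
    have hle : lengthSqDist v i / φ ≤ 0 := by simpa [← hp] using h.div_le i
    have hge : 0 ≤ lengthSqDist v i / φ := div_nonneg (lengthSqDist_nonneg v i) hφ.le
    have : lengthSqDist v i / φ = 0 := le_antisymm hle hge
    simp [← hp, this]
  · field_simp

/-- Total acceptance probability of the rejection sampler is exactly `1/φ` ("we can convert a sample
from `p` to a sample from `𝒟_v` with probability `1/φ`"). [cite: ChiaEtAl2022, §2.2, text after Def. 2.7] -/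
theorem sum_acceptMass (h : IsOversampledDist φ v p) (hv : v ≠ 0) (hφ : 0 < φ) :
    ∑ i, acceptMass φ v p i = 1 / φ := by
  simp_rw [h.acceptMass_eq hφ, ← sum_div, sum_lengthSqDist hv]

end IsOversampledDist

/-! ### Oversampling and query access `SQ_φ(v)` (Def. 2.8) -/

/-- The data of `φ`-oversampling access to `v` beyond query access to `v` itself: an entrywise
dominating vector `ṽ` ("entry-wise upper bound") to which one has exact sampling-and-query access,
with `‖ṽ‖² = φ‖v‖²` and `|ṽ(i)|² ≥ |v(i)|²`. [cite: ChiaEtAl2022, Def. 2.8] -/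
structure OversamplingWitness (φ : ℝ) (v : Fin n → ℝ) where
  /-- the dominating vector `ṽ` -/
  tilde : Fin n → ℝ
  /-- `‖ṽ‖² = φ ‖v‖²` -/
  normSq_tilde : normSq tilde = φ * normSq v
  /-- `|ṽ(i)|² ≥ |v(i)|²` -/
  sq_le : ∀ i, v i ^ 2 ≤ tilde i ^ 2

namespace OversamplingWitness

variable {φ : ℝ} {v : Fin n → ℝ}

/-- "`SQ₁(v)` is the same as `SQ(v)`, if we take `ṽ = v`." [cite: ChiaEtAl2022, Def. 2.8] -/
def refl (v : Fin n → ℝ) : OversamplingWitness 1 v where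
  tilde := v
  normSq_tilde := by rw [one_mul]
  sq_le _ := le_rfl

/-- The witness of `SQ₁(v) = SQ(v)` is `v` itself. [cite: ChiaEtAl2022, Def. 2.8] -/
@[simp] theorem refl_tilde (v : Fin n → ℝ) : (refl v).tilde = v := rfl

/-- `‖v‖² ≤ ‖ṽ‖²` (sum the entrywise domination). [cite: ChiaEtAl2022, Def. 2.8] -/
theorem normSq_le (w : OversamplingWitness φ v) : normSq v ≤ normSq w.tilde :=
  sum_le_sum fun i _ => w.sq_le i

/-- An oversampling witness of a nonzero vector has factor `φ ≥ 1`. [cite: ChiaEtAl2022, Def. 2.8] -/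
theorem one_le (w : OversamplingWitness φ v) (hv : v ≠ 0) : 1 ≤ φ := by
  have h := w.normSq_le
  rw [w.normSq_tilde] at h
  exact (le_mul_iff_one_le_left (normSq_pos hv)).1 h

/-- The dominating vector of a nonzero vector is nonzero. [cite: ChiaEtAl2022, Def. 2.8] -/
theorem tilde_ne_zero (w : OversamplingWitness φ v) (hv : v ≠ 0) : w.tilde ≠ 0 := by
  intro h
  have := w.normSq_le
  rw [h, (normSq_eq_zero_iff _).2 rfl] at this
  exact absurd this (not_le.2 (normSq_pos hv))

/-- `φ > 0` for a witness of a nonzero vector. [cite: ChiaEtAl2022, Def. 2.8] -/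
theorem pos (w : OversamplingWitness φ v) (hv : v ≠ 0) : 0 < φ :=
  lt_of_lt_of_le one_pos (w.one_le hv)

/-- The sampling distribution `𝒟_ṽ` available under `SQ_φ(v)` is a `φ`-oversampled importance
sampling distribution of `v`. [cite: ChiaEtAl2022, Def. 2.8 (notation `p(i) := 𝒟_ṽ(i)`)] -/
theorem isOversampledDist (w : OversamplingWitness φ v) (hv : v ≠ 0) :
    IsOversampledDist φ v (lengthSqDist w.tilde) := by
  refine ⟨lengthSqDist_nonneg _, sum_lengthSqDist (w.tilde_ne_zero hv), fun i => ?_⟩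
  have hφ := w.pos hv
  have hnv := normSq_pos hv
  unfold lengthSqDist
  rw [w.normSq_tilde, div_div, mul_comm]
  exact div_le_div_of_nonneg_right (w.sq_le i) (mul_pos hφ hnv).le

/-! ### Linear combinations (§2.2 lemma "Linear combinations" = Tang 2019, Prop. 4.3) -/

section linComb

variable {k : ℕ} {φs : Fin k → ℝ} {vs : Fin k → Fin n → ℝ}

/-- The dominating vector for `∑_t λ_t v_t` built from witnesses `ṽ_t`:
`ṽ(i) = √(k · ∑_t λ_t² ṽ_t(i)²)`. [cite: ChiaEtAl2022, §2.2 (Linear combinations); TangEwin2019, Prop. 4.3] -/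
def linCombTilde (ws : ∀ t, OversamplingWitness (φs t) (vs t)) (c : Fin k → ℝ) (i : Fin n) : ℝ :=
  Real.sqrt (k * ∑ t, c t ^ 2 * (ws t).tilde i ^ 2)

/-- `ṽ(i)² = k ∑_t λ_t² ṽ_t(i)²`. [cite: ChiaEtAl2022, §2.2 (Linear combinations)] -/
theorem linCombTilde_sq (ws : ∀ t, OversamplingWitness (φs t) (vs t)) (c : Fin k → ℝ) (i : Fin n) :
    linCombTilde ws c i ^ 2 = k * ∑ t, c t ^ 2 * (ws t).tilde i ^ 2 :=
  Real.sq_sqrt (mul_nonneg (Nat.cast_nonneg k)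
    (sum_nonneg fun _ _ => mul_nonneg (sq_nonneg _) (sq_nonneg _)))

/-- `‖ṽ‖² = k ∑_t φ_t ‖λ_t v_t‖²`. [cite: ChiaEtAl2022, §2.2 (Linear combinations)] -/
theorem normSq_linCombTilde (ws : ∀ t, OversamplingWitness (φs t) (vs t)) (c : Fin k → ℝ) :
    normSq (linCombTilde ws c) = k * ∑ t, φs t * normSq (c t • vs t) := by
  have hrhs : ∀ t, φs t * normSq (c t • vs t) = c t ^ 2 * ∑ i, (ws t).tilde i ^ 2 := by
    intro t
    rw [normSq_smul, ← mul_assoc, mul_comm (φs t), mul_assoc, ← (ws t).normSq_tilde]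
    rfl
  simp_rw [hrhs]
  unfold normSq
  simp_rw [linCombTilde_sq, ← mul_sum]
  congr 1
  rw [sum_comm]
  exact sum_congr rfl fun t _ => by rw [mul_sum]

/-- Cauchy–Schwarz step: `(∑_t λ_t v_t(i))² ≤ k ∑_t λ_t² ṽ_t(i)²`. [folklore] -/
theorem sq_sum_le_linCombTilde_sq (ws : ∀ t, OversamplingWitness (φs t) (vs t)) (c : Fin k → ℝ)
    (i : Fin n) : (∑ t, c t * vs t i) ^ 2 ≤ linCombTilde ws c i ^ 2 := by
  rw [linCombTilde_sq]
  calc (∑ t, c t * vs t i) ^ 2 = (∑ t, (c t * vs t i) * 1) ^ 2 := by simp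
    _ ≤ (∑ t, (c t * vs t i) ^ 2) * ∑ _t : Fin k, (1 : ℝ) ^ 2 :=
        sum_mul_sq_le_sq_mul_sq _ _ _
    _ = k * ∑ t, c t ^ 2 * vs t i ^ 2 := by simp [mul_pow, mul_comm]
    _ ≤ k * ∑ t, c t ^ 2 * (ws t).tilde i ^ 2 :=
        mul_le_mul_of_nonneg_left
          (sum_le_sum fun t _ => mul_le_mul_of_nonneg_left ((ws t).sq_le i) (sq_nonneg _))
          (Nat.cast_nonneg k)

/-- **Linear combinations.** Given `SQ_{φ_t}(v_t)` for `t < k` and scalars `λ_t`, one has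
`SQ_φ(∑_t λ_t v_t)` with `φ = k (∑_t φ_t ‖λ_t v_t‖²) / ‖∑_t λ_t v_t‖²`: the witness is `linCombTilde`.
(The hypothesis `∑_t λ_t v_t ≠ 0` is the paper's implicit `‖∑ λ_t v_t‖ ≠ 0` in the denominator.)
[cite: ChiaEtAl2022, §2.2 (Linear combinations, "Proposition 4.3 of [Tang 2019]"); TangEwin2019, Prop. 4.3] -/
def linComb (ws : ∀ t, OversamplingWitness (φs t) (vs t)) (c : Fin k → ℝ)
    (hne : ∑ t, c t • vs t ≠ 0) :
    OversamplingWitness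
      (k * (∑ t, φs t * normSq (c t • vs t)) / normSq (∑ t, c t • vs t)) (∑ t, c t • vs t) where
  tilde := linCombTilde ws c
  normSq_tilde := by
    rw [normSq_linCombTilde, div_mul_cancel₀ _ (normSq_pos hne).ne']
  sq_le i := by
    have : (∑ t, c t • vs t) i = ∑ t, c t * vs t i := by simp [Finset.sum_apply]
    rw [this]
    exact sq_sum_le_linCombTilde_sq ws c i

/-- The sampler behind the lemma: choosing `t` with probability `∝ λ_t² ‖ṽ_t‖²` and then
`i ∼ 𝒟_{ṽ_t}` produces exactly `𝒟_ṽ` for `ṽ = linCombTilde` (mixture identity), so `SQ(ṽ)` costs one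
sample of some `ṽ_t` after the norms are known. [cite: ChiaEtAl2022, §2.2 (Linear combinations)] -/
theorem mixture_eq_lengthSqDist_linCombTilde (ws : ∀ t, OversamplingWitness (φs t) (vs t))
    (c : Fin k → ℝ) (i : Fin n) (hS : ∑ t, c t ^ 2 * normSq (ws t).tilde ≠ 0) :
    ∑ t, (c t ^ 2 * normSq (ws t).tilde / ∑ s, c s ^ 2 * normSq (ws s).tilde) *
        lengthSqDist (ws t).tilde i = lengthSqDist (linCombTilde ws c) i := by
  have hk : (k : ℝ) ≠ 0 := by
    rintro hk0
    apply hS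
    have : k = 0 := by exact_mod_cast hk0
    subst this
    simp
  -- each summand equals `λ_t² ṽ_t(i)² / S` (also when `‖ṽ_t‖ = 0`, where `ṽ_t = 0`)
  have hterm : ∀ t, (c t ^ 2 * normSq (ws t).tilde / ∑ s, c s ^ 2 * normSq (ws s).tilde) *
      lengthSqDist (ws t).tilde i =
      c t ^ 2 * (ws t).tilde i ^ 2 / ∑ s, c s ^ 2 * normSq (ws s).tilde := by
    intro t
    unfold lengthSqDist
    rcases eq_or_ne (normSq (ws t).tilde) 0 with h0 | h0
    · have : (ws t).tilde = 0 := (normSq_eq_zero_iff _).1 h0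
      simp [this]
    · field_simp
  simp_rw [hterm, ← sum_div]
  unfold lengthSqDist
  rw [linCombTilde_sq, normSq_linCombTilde]
  have hS' : ∑ t, φs t * normSq (c t • vs t) = ∑ t, c t ^ 2 * normSq (ws t).tilde := by
    refine sum_congr rfl fun t _ => ?_
    rw [normSq_smul, (ws t).normSq_tilde]; ring
  rw [hS', mul_div_mul_left _ _ hk]

end linComb

end OversamplingWitness

/-! ### Matrices (Def. 2.9): row-norm sampling and the Frobenius distribution -/

section matrix

variable {m : ℕ}

/-- `‖A‖_F² = ∑_{i,j} A(i,j)²`. [cite: ChiaEtAl2022, §2.1 notation] -/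
def frobSq (A : Matrix (Fin m) (Fin n) ℝ) : ℝ := ∑ i, normSq (A i)

/-- `‖A‖_F² = ∑_{i,j} A(i,j)²` (definitional). [folklore] -/
theorem frobSq_eq_sum_sq (A : Matrix (Fin m) (Fin n) ℝ) : frobSq A = ∑ i, ∑ j, A i j ^ 2 := rfl

/-- `‖A‖_F²` is the squared norm of the vector of row norms `a = (‖A(1,·)‖, …, ‖A(m,·)‖)`.
[cite: ChiaEtAl2022, Def. 2.9] -/
theorem frobSq_eq_normSq_rowNorms (A : Matrix (Fin m) (Fin n) ℝ) :
    frobSq A = normSq (fun i => Real.sqrt (normSq (A i))) := by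
  unfold frobSq
  refine sum_congr rfl fun i _ => ?_
  rw [Real.sq_sqrt (normSq_nonneg _)]

/-- The row distribution `𝒟_a(i) = ‖A(i,·)‖²/‖A‖_F²` of `SQ(A)` (sampling access to the vector `a` of
row norms). [cite: ChiaEtAl2022, Def. 2.9] -/
def rowDist (A : Matrix (Fin m) (Fin n) ℝ) (i : Fin m) : ℝ := normSq (A i) / frobSq A

/-- `𝒟_a` for the row-norm vector `a` is `rowDist`. [cite: ChiaEtAl2022, Def. 2.9] -/
theorem rowDist_eq_lengthSqDist (A : Matrix (Fin m) (Fin n) ℝ) :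
    rowDist A = lengthSqDist (fun i => Real.sqrt (normSq (A i))) := by
  funext i
  rw [rowDist, lengthSqDist, Real.sq_sqrt (normSq_nonneg _), frobSq_eq_normSq_rowNorms]

/-- Two-stage sampling `i ∼ 𝒟_a`, then `j ∼ 𝒟_{A(i,·)}` outputs `(i,j)` with probability
`|A(i,j)|²/‖A‖_F²` ("`SQ(A)` implies `SQ(vec A)`"). Holds also on zero rows with the junk value
`𝒟_0 = 0`. [cite: ChiaEtAl2022, §2.2, remark after Def. 2.9] -/
theorem rowDist_mul_lengthSqDist (A : Matrix (Fin m) (Fin n) ℝ) (i : Fin m) (j : Fin n) :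
    rowDist A i * lengthSqDist (A i) j = A i j ^ 2 / frobSq A := by
  unfold rowDist lengthSqDist
  rcases eq_or_ne (normSq (A i)) 0 with h0 | h0
  · have hrow : A i = 0 := (normSq_eq_zero_iff _).1 h0
    have : A i j = 0 := by simpa using congrFun hrow j
    simp [h0, this]
  · rw [div_mul_div_comm, mul_comm (normSq (A i)), ← div_mul_div_comm, div_self h0, mul_one]

/-- The two-stage sample is a probability distribution on `[m] × [n]` when `A ≠ 0`.
[cite: ChiaEtAl2022, §2.2, remark after Def. 2.9] -/
theorem sum_rowDist_mul_lengthSqDist {A : Matrix (Fin m) (Fin n) ℝ} (hA : frobSq A ≠ 0) :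
    ∑ i, ∑ j, rowDist A i * lengthSqDist (A i) j = 1 := by
  simp_rw [rowDist_mul_lengthSqDist, ← sum_div]
  exact div_self hA

end matrix

/-! ### Inner product estimation (Tang 2019, Prop. 4.2; CGLLTW 2022, §3.2 "Inner product estimation")

The single-sample estimator behind every SQ inner-product routine: draw `i ∼ 𝒟_x` and output
`Z = y(i)/x(i)`.  Tang's proof displays `E[Z] = Σ (y_i/x_i)(x_i²/‖x‖²) = ⟨x,y⟩/‖x‖²` and
`Var[Z] ≤ Σ (y_i/x_i)²(x_i²/‖x‖²) = ‖y‖²/‖x‖²` [cite: TangEwin2019, Proposition 4.2 and its proof];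
the median-of-means step ("the median of `6 log(1/δ)` copies of the mean of `9/(2ε²)` copies")
is probability bookkeeping and is not formalised.  With a `φ`-oversampling witness `x̃` one samples
`i ∼ 𝒟_x̃` and outputs `x(i) y(i)/x̃(i)²`; the same computation gives mean `⟨x,y⟩/‖x̃‖²` and second
moment `≤ ‖y‖²/‖x̃‖²`, i.e. after multiplying by `‖x̃‖² = φ‖x‖²` an unbiased estimator of `⟨x,y⟩`
with second moment `≤ φ‖x‖²‖y‖²` — the `φ‖u‖²‖v‖²/ε²` of [cite: ChiaEtAl2022, §3.2, Lemma "Inner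
product estimation" (restating Tang 2019 Prop. 4.2 for `SQ_φ(u), Q(v)`)].  The sums below are
exactly those displayed expectations (as finite weighted sums; indices with `x̃(i) = 0` carry
weight `0` and, by domination, `x(i) = 0`). -/

namespace OversamplingWitness

variable {φ : ℝ} {x : Fin n → ℝ}

/-- Domination forces `x(i) = 0` wherever `x̃(i) = 0`. [cite: ChiaEtAl2022, Def. 2.8] -/
theorem eq_zero_of_tilde_eq_zero (w : OversamplingWitness φ x) {i : Fin n} (h : w.tilde i = 0) :
    x i = 0 := by
  have := w.sq_le i
  rw [h] at this
  exact pow_eq_zero_iff (n := 2) (by norm_num) |>.1 (le_antisymm (by simpa using this) (sq_nonneg _))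

/-- **Unbiasedness** of the oversampled inner-product estimator:
`Σ_i 𝒟_x̃(i) · (x_i y_i / x̃_i²) = ⟨x, y⟩ / ‖x̃‖²`. [cite: TangEwin2019, Proposition 4.2 (proof,
first display, with `x̃ = x`)]; [cite: ChiaEtAl2022, §3.2 Lemma "Inner product estimation"] -/
theorem sum_lengthSqDist_mul_ipEst (w : OversamplingWitness φ x) (hx : x ≠ 0) (y : Fin n → ℝ) :
    ∑ i, lengthSqDist w.tilde i * (x i * y i / w.tilde i ^ 2)
      = (∑ i, x i * y i) / normSq w.tilde := by
  have hN : normSq w.tilde ≠ 0 := (normSq_pos (w.tilde_ne_zero hx)).ne'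
  rw [sum_div]
  refine sum_congr rfl fun i _ => ?_
  unfold lengthSqDist
  rcases eq_or_ne (w.tilde i) 0 with h | h
  · rw [w.eq_zero_of_tilde_eq_zero h, h]; simp
  · field_simp

/-- **Second moment** of the oversampled inner-product estimator:
`Σ_i 𝒟_x̃(i) · (x_i y_i / x̃_i²)² ≤ ‖y‖² / ‖x̃‖²` (hence, after scaling by `‖x̃‖² = φ‖x‖²`, a second
moment `≤ φ‖x‖²‖y‖²`). [cite: TangEwin2019, Proposition 4.2 (proof, second display, `x̃ = x`)];
[cite: ChiaEtAl2022, §3.2 Lemma "Inner product estimation"] -/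
theorem sum_lengthSqDist_mul_ipEst_sq_le (w : OversamplingWitness φ x) (hx : x ≠ 0)
    (y : Fin n → ℝ) :
    ∑ i, lengthSqDist w.tilde i * (x i * y i / w.tilde i ^ 2) ^ 2
      ≤ normSq y / normSq w.tilde := by
  have hNpos : 0 < normSq w.tilde := normSq_pos (w.tilde_ne_zero hx)
  unfold normSq
  rw [sum_div]
  refine sum_le_sum fun i _ => ?_
  unfold lengthSqDist normSq
  rcases eq_or_ne (w.tilde i) 0 with h | h
  · rw [w.eq_zero_of_tilde_eq_zero h, h]
    simp only [ne_eq, OfNat.ofNat_ne_zero, not_false_eq_true, zero_pow, zero_div, zero_mul,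
      mul_zero]
    exact div_nonneg (sq_nonneg _) hNpos.le
  · have ht : 0 < w.tilde i ^ 2 := by positivity
    -- `(x̃ᵢ²/N) · (xᵢ yᵢ / x̃ᵢ²)² = xᵢ² yᵢ² / (x̃ᵢ² N) ≤ yᵢ² / N` since `xᵢ² ≤ x̃ᵢ²`
    have key : w.tilde i ^ 2 / (∑ j, w.tilde j ^ 2) * (x i * y i / w.tilde i ^ 2) ^ 2
        = (x i ^ 2 / w.tilde i ^ 2) * (y i ^ 2 / ∑ j, w.tilde j ^ 2) := by
      field_simp
    rw [key]
    calc x i ^ 2 / w.tilde i ^ 2 * (y i ^ 2 / ∑ j, w.tilde j ^ 2)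
        ≤ 1 * (y i ^ 2 / ∑ j, w.tilde j ^ 2) := by
          apply mul_le_mul_of_nonneg_right _ (div_nonneg (sq_nonneg _) hNpos.le)
          exact (div_le_one ht).2 (w.sq_le i)
      _ = y i ^ 2 / ∑ j, w.tilde j ^ 2 := one_mul _

/-- The scaled estimator `‖x̃‖² · x_i y_i / x̃_i²` is unbiased for `⟨x,y⟩`.
[cite: TangEwin2019, Proposition 4.2 ("Since we know `‖x‖`, we can normalize by it to get a random
variable whose mean is `⟨x,y⟩`")]; [cite: ChiaEtAl2022, §3.2] -/
theorem sum_lengthSqDist_mul_ipEst_scaled (w : OversamplingWitness φ x) (hx : x ≠ 0)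
    (y : Fin n → ℝ) :
    ∑ i, lengthSqDist w.tilde i * (normSq w.tilde * (x i * y i / w.tilde i ^ 2))
      = ∑ i, x i * y i := by
  have hN : normSq w.tilde ≠ 0 := (normSq_pos (w.tilde_ne_zero hx)).ne'
  have := w.sum_lengthSqDist_mul_ipEst hx y
  simp_rw [mul_left_comm (lengthSqDist _ _) (normSq _) _, ← mul_sum, this]
  exact mul_div_cancel₀ _ hN

/-- Second moment of the scaled estimator: `≤ ‖x̃‖² ‖y‖² = φ ‖x‖² ‖y‖²`.
[cite: ChiaEtAl2022, §3.2 Lemma "Inner product estimation" (the factor `φ‖u‖²‖v‖²/ε²`)];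
[cite: TangEwin2019, Proposition 4.2 (`σ = ‖x‖‖y‖` for `φ = 1`)] -/
theorem sum_lengthSqDist_mul_ipEst_scaled_sq_le (w : OversamplingWitness φ x) (hx : x ≠ 0)
    (y : Fin n → ℝ) :
    ∑ i, lengthSqDist w.tilde i * (normSq w.tilde * (x i * y i / w.tilde i ^ 2)) ^ 2
      ≤ φ * normSq x * normSq y := by
  have hNpos : 0 < normSq w.tilde := normSq_pos (w.tilde_ne_zero hx)
  have h := w.sum_lengthSqDist_mul_ipEst_sq_le hx y
  have : ∑ i, lengthSqDist w.tilde i * (normSq w.tilde * (x i * y i / w.tilde i ^ 2)) ^ 2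
      = normSq w.tilde ^ 2 * ∑ i, lengthSqDist w.tilde i * (x i * y i / w.tilde i ^ 2) ^ 2 := by
    rw [mul_sum]; exact sum_congr rfl fun i _ => by ring
  rw [this, ← w.normSq_tilde]
  calc normSq w.tilde ^ 2 * ∑ i, lengthSqDist w.tilde i * (x i * y i / w.tilde i ^ 2) ^ 2
      ≤ normSq w.tilde ^ 2 * (normSq y / normSq w.tilde) :=
        mul_le_mul_of_nonneg_left h (sq_nonneg _)
    _ = normSq w.tilde * normSq y := by
        field_simp

end OversamplingWitness

/-- Tang's Proposition 4.2 computation verbatim (`φ = 1`, `x̃ = x`): with `Z = y_i/x_i` drawn from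
`𝒟_x`, `E[Z] = ⟨x,y⟩/‖x‖²`. [cite: TangEwin2019, Proposition 4.2 (proof, first display)] -/
theorem sum_lengthSqDist_mul_div {x : Fin n → ℝ} (hx : x ≠ 0) (y : Fin n → ℝ) :
    ∑ i, lengthSqDist x i * (y i / x i) = (∑ i, x i * y i) / normSq x := by
  have h := (OversamplingWitness.refl x).sum_lengthSqDist_mul_ipEst hx y
  simp only [OversamplingWitness.refl_tilde] at h
  rw [← h]
  refine sum_congr rfl fun i _ => ?_
  rcases eq_or_ne (x i) 0 with h0 | h0
  · simp [lengthSqDist, h0]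
  · congr 1; field_simp

/-- Tang's Proposition 4.2 computation verbatim (`φ = 1`): `E[Z²] ≤ ‖y‖²/‖x‖²` for `Z = y_i/x_i`
drawn from `𝒟_x` (so `σ² ≤ ‖x‖²‖y‖²` after normalising by `‖x‖²`).
[cite: TangEwin2019, Proposition 4.2 (proof, second display)] -/
theorem sum_lengthSqDist_mul_div_sq_le {x : Fin n → ℝ} (hx : x ≠ 0) (y : Fin n → ℝ) :
    ∑ i, lengthSqDist x i * (y i / x i) ^ 2 ≤ normSq y / normSq x := by
  have h := (OversamplingWitness.refl x).sum_lengthSqDist_mul_ipEst_sq_le hx y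
  simp only [OversamplingWitness.refl_tilde] at h
  refine le_of_eq_of_le ?_ h
  refine sum_congr rfl fun i _ => ?_
  rcases eq_or_ne (x i) 0 with h0 | h0
  · simp [lengthSqDist, h0]
  · congr 1; field_simp

/-! ### Rejection sampling from `SQ_φ(v)`: how many rounds (§2.2, Lemma "oversampling", first statement)

[cite: ChiaEtAl2022, §2.2 (after Def. 2.8), Lemma: "Suppose we are given `SQ_φ(v)` and some
`δ ∈ (0,1]`. Denote `sq(v) := φ sq_φ(v) log(1/δ)`. We can sample from `𝒟_v` with probability
`≥ 1 − δ` in `O(sq(v))` time."]  One round draws `i ∼ p` and accepts with probability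
`(𝒟_v(i)/p(i))/φ`; it accepts with total probability exactly `1/φ` (`sum_acceptMass`) and, given
acceptance, outputs `i ∼ 𝒟_v` (`acceptMass_eq`).  Here: the weight of the `T`-round transcripts
`ω ∈ [n]^T` in which EVERY round rejects is `(1 − 1/φ)^T ≤ e^{−T/φ}`, hence `≤ δ` as soon as
`T ≥ φ ln(1/δ)` — the printed `O(φ log(1/δ))` rounds. -/

section rejectionRounds

variable {φ : ℝ} {v p : Fin n → ℝ}

/-- One round of the rejection sampler rejects with total weight `∑_i (p(i) − p(i)·a(i)) = 1 − 1/φ`,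
`a(i) = (𝒟_v(i)/p(i))/φ`. [cite: ChiaEtAl2022, §2.2, text after Def. 2.7 ("with probability `1/φ`")] -/
theorem IsOversampledDist.sum_sub_acceptMass (h : IsOversampledDist φ v p) (hv : v ≠ 0)
    (hφ : 0 < φ) : ∑ i, (p i - acceptMass φ v p i) = 1 - 1 / φ := by
  rw [Finset.sum_sub_distrib, h.sum_eq_one, h.sum_acceptMass hv hφ]

/-- Independent rounds: the total weight of the transcripts `ω ∈ [n]^T` in which every one of the
`T` rounds rejects is `(1 − 1/φ)^T`.
[cite: ChiaEtAl2022, §2.2 Lemma "oversampling", first statement (repeat until acceptance)] -/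
theorem IsOversampledDist.allReject_weight (h : IsOversampledDist φ v p) (hv : v ≠ 0) (hφ : 0 < φ)
    (T : ℕ) : ∑ ω : Fin T → Fin n, ∏ t, (p (ω t) - acceptMass φ v p (ω t)) = (1 - 1 / φ) ^ T := by
  classical
  rw [← Fintype.piFinset_univ, ← Finset.prod_univ_sum (fun _ => (Finset.univ : Finset (Fin n)))
    (fun _ i => p i - acceptMass φ v p i)]
  simp [h.sum_sub_acceptMass hv hφ]

/-- `(1 − 1/φ)^T ≤ e^{−T/φ}` for `φ ≥ 1` (from `1 + x ≤ eˣ`; private helper). [folklore] -/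
private theorem one_sub_inv_pow_le_exp (hφ : 1 ≤ φ) (T : ℕ) :
    (1 - 1 / φ) ^ T ≤ Real.exp (-(T : ℝ) / φ) := by
  have hφ0 : 0 < φ := by linarith
  have h0 : 0 ≤ 1 - 1 / φ := by
    have : 1 / φ ≤ 1 := by rw [div_le_one hφ0]; exact hφ
    linarith
  have h1 : 1 - 1 / φ ≤ Real.exp (-(1 / φ)) := by
    have := Real.add_one_le_exp (-(1 / φ))
    linarith
  calc (1 - 1 / φ) ^ T ≤ (Real.exp (-(1 / φ))) ^ T := pow_le_pow_left₀ h0 h1 T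
    _ = Real.exp (-(T : ℝ) / φ) := by rw [← Real.exp_nat_mul]; congr 1; ring

/-- **Rounds bound** (CGLLTW 2022 §2.2 Lemma "oversampling", first statement): with
`T ≥ φ ln(1/δ)` rounds the rejection sampler fails to produce a sample from `𝒟_v` (every round
rejects) with total weight at most `δ`.
[cite: ChiaEtAl2022, §2.2 Lemma "oversampling" ("We can sample from `𝒟_v` with probability
`≥ 1 − δ` in `O(φ sq_φ(v) log(1/δ))` time")] -/
theorem IsOversampledDist.allReject_weight_le (h : IsOversampledDist φ v p) (hv : v ≠ 0)
    (hφ : 0 < φ) {T : ℕ} {δ : ℝ} (hδ : 0 < δ) (hT : φ * Real.log (1 / δ) ≤ T) :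
    ∑ ω : Fin T → Fin n, ∏ t, (p (ω t) - acceptMass φ v p (ω t)) ≤ δ := by
  rw [h.allReject_weight hv hφ T]
  refine (one_sub_inv_pow_le_exp (h.one_le hv hφ) T).trans ?_
  rw [Real.log_div (by norm_num) hδ.ne', Real.log_one, zero_sub] at hT
  have hle : -(T : ℝ) / φ ≤ Real.log δ := by
    rw [div_le_iff₀ hφ]
    linarith
  calc Real.exp (-(T : ℝ) / φ) ≤ Real.exp (Real.log δ) := Real.exp_le_exp.2 hle
    _ = δ := Real.exp_log hδ

end rejectionRounds

/-! ### `ℓ²`-closeness implies closeness in total variation of the length-square distributions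

Tang, STOC 2019, **§4.1 "Vector Sampling", Lemma 4.1**:

> For `x, y ∈ ℝⁿ` satisfying `‖x − y‖ ≤ ε`, the corresponding distributions `𝒟_x, 𝒟_y` satisfy
> `‖𝒟_x − 𝒟_y‖_TV ≤ 2ε/‖x‖`.

with its printed proof: for the normalised vectors `x̂ = x/‖x‖`, `ŷ = y/‖y‖`,
`‖𝒟_x − 𝒟_y‖_TV = ½∑|x̂_i² − ŷ_i²| = ½⟨|x̂ − ŷ|, |x̂ + ŷ|⟩ ≤ ½‖x̂ − ŷ‖‖x̂ + ŷ‖ ≤ ‖x̂ − ŷ‖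
= (1/‖x‖)‖x − y − (‖x‖ − ‖y‖)ŷ‖ ≤ (1/‖x‖)(‖x − y‖ + |‖x‖ − ‖y‖|) ≤ 2ε/‖x‖` ("The first
inequality follows from Cauchy–Schwarz, and the rest follow from triangle inequality").  The total
variation distance is taken in its half-`ℓ¹` form `½∑_i |𝒟_x(i) − 𝒟_y(i)|` (the same quantity as
`Literature.Probability.MarkovChains.tvDist`, not imported here to keep this file's imports small);
`‖v‖ = √(normSq v)`.  Used downstream wherever an approximate vector is sampled in place of the
exact one (Tang 2019 Thm 1 / §4.3; CGLLTW 2022 §2.2). -/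

section vectorSamplingTV

variable {x y : Fin n → ℝ}

/-- Cauchy–Schwarz for the absolute values of two real vectors: `∑|u_i||w_i| ≤ ‖u‖‖w‖`. [folklore] -/
private theorem sum_abs_mul_abs_le (u w : Fin n → ℝ) :
    ∑ i, |u i| * |w i| ≤ Real.sqrt (normSq u) * Real.sqrt (normSq w) := by
  have h := Real.sum_mul_le_sqrt_mul_sqrt Finset.univ (fun i => |u i|) (fun i => |w i|)
  simpa [normSq, sq_abs] using h

/-- Triangle inequality for `‖·‖ = √normSq`. [folklore] -/
private theorem sqrt_normSq_add_le (u w : Fin n → ℝ) :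
    Real.sqrt (normSq (u + w)) ≤ Real.sqrt (normSq u) + Real.sqrt (normSq w) := by
  have hu := Real.sqrt_nonneg (normSq u)
  have hw := Real.sqrt_nonneg (normSq w)
  rw [Real.sqrt_le_left (by positivity)]
  have hcs : ∑ i, u i * w i ≤ Real.sqrt (normSq u) * Real.sqrt (normSq w) :=
    (sum_le_sum fun i _ => (le_abs_self _).trans_eq (abs_mul (u i) (w i))).trans
      (sum_abs_mul_abs_le u w)
  have hexp : normSq (u + w) = normSq u + 2 * ∑ i, u i * w i + normSq w := by
    simp only [normSq, Pi.add_apply, add_sq, sum_add_distrib, mul_sum]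
    ring_nf
  rw [hexp, add_sq, Real.sq_sqrt (normSq_nonneg u), Real.sq_sqrt (normSq_nonneg w)]
  nlinarith

/-- `‖c • u‖ = |c| ‖u‖`. [folklore] -/
private theorem sqrt_normSq_smul (c : ℝ) (u : Fin n → ℝ) :
    Real.sqrt (normSq (c • u)) = |c| * Real.sqrt (normSq u) := by
  rw [normSq_smul, Real.sqrt_mul (sq_nonneg c), Real.sqrt_sq_eq_abs]

/-- `‖u − w‖ ≤ ‖u‖ + ‖w‖`. [folklore] -/
private theorem sqrt_normSq_sub_le (u w : Fin n → ℝ) :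
    Real.sqrt (normSq (u - w)) ≤ Real.sqrt (normSq u) + Real.sqrt (normSq w) := by
  have h := sqrt_normSq_add_le u (-w)
  have hneg : normSq (-w) = normSq w := by simp [normSq]
  rw [hneg, ← sub_eq_add_neg] at h
  exact h

/-- Reverse triangle inequality `|‖x‖ − ‖y‖| ≤ ‖x − y‖`. [folklore] -/
private theorem abs_sqrt_normSq_sub_le (u w : Fin n → ℝ) :
    |Real.sqrt (normSq u) - Real.sqrt (normSq w)| ≤ Real.sqrt (normSq (u - w)) := by
  rw [abs_sub_le_iff]
  constructor
  · have h := sqrt_normSq_add_le (u - w) w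
    rw [sub_add_cancel] at h
    linarith
  · have h := sqrt_normSq_add_le (w - u) u
    rw [sub_add_cancel] at h
    have : normSq (w - u) = normSq (u - w) := by
      simp only [normSq, Pi.sub_apply]
      exact sum_congr rfl fun i _ => by ring
    rw [this] at h
    linarith

/-- The normalised vector `x̂ = x/‖x‖` has `x̂_i² = 𝒟_x(i)`. [cite: TangEwin2019, §4.1, proof of
Lemma 4.1 ("Let `x̂` and `ŷ` be the normalized vectors `x/‖x‖` and `y/‖y‖`")] -/
theorem normalize_sq_eq_lengthSqDist (x : Fin n → ℝ) (i : Fin n) :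
    ((1 / Real.sqrt (normSq x)) • x) i ^ 2 = lengthSqDist x i := by
  simp only [Pi.smul_apply, smul_eq_mul, lengthSqDist]
  rw [mul_pow, one_div, inv_pow, Real.sq_sqrt (normSq_nonneg x)]
  ring

/-- `‖x̂‖ = 1` for `x ≠ 0`. [cite: TangEwin2019, §4.1, proof of Lemma 4.1] -/
theorem sqrt_normSq_normalize {x : Fin n → ℝ} (hx : x ≠ 0) :
    Real.sqrt (normSq ((1 / Real.sqrt (normSq x)) • x)) = 1 := by
  have hpos : 0 < Real.sqrt (normSq x) := Real.sqrt_pos.2 (normSq_pos hx)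
  rw [sqrt_normSq_smul, abs_of_pos (by positivity), one_div, inv_mul_cancel₀ hpos.ne']

/-- **Tang 2019, Lemma 4.1** (`ℓ²`-closeness ⇒ TV-closeness of the length-square distributions):
for non-zero `x, y ∈ ℝⁿ` with `‖x − y‖ ≤ ε`, `½∑_i |𝒟_x(i) − 𝒟_y(i)| ≤ 2ε/‖x‖`.
[cite: TangEwin2019, §4.1 Lemma 4.1 and its proof (Cauchy–Schwarz, then
`‖x̂ − ŷ‖ = ‖x − y − (‖x‖ − ‖y‖)ŷ‖/‖x‖ ≤ (‖x − y‖ + |‖x‖ − ‖y‖|)/‖x‖ ≤ 2ε/‖x‖`)] -/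
theorem tv_lengthSqDist_le (hx : x ≠ 0) (hy : y ≠ 0) {ε : ℝ}
    (hε : Real.sqrt (normSq (x - y)) ≤ ε) :
    (1 / 2) * ∑ i, |lengthSqDist x i - lengthSqDist y i| ≤ 2 * ε / Real.sqrt (normSq x) := by
  set a := Real.sqrt (normSq x) with ha
  set b := Real.sqrt (normSq y) with hb
  have hapos : 0 < a := Real.sqrt_pos.2 (normSq_pos hx)
  have hbpos : 0 < b := Real.sqrt_pos.2 (normSq_pos hy)
  set xh : Fin n → ℝ := (1 / a) • x with hxh
  set yh : Fin n → ℝ := (1 / b) • y with hyh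
  have hxh1 : Real.sqrt (normSq xh) = 1 := sqrt_normSq_normalize hx
  have hyh1 : Real.sqrt (normSq yh) = 1 := sqrt_normSq_normalize hy
  -- ½∑|x̂² − ŷ²| = ½∑|x̂ − ŷ||x̂ + ŷ| ≤ ½‖x̂ − ŷ‖‖x̂ + ŷ‖ ≤ ‖x̂ − ŷ‖
  have step1 : (1 / 2) * ∑ i, |lengthSqDist x i - lengthSqDist y i|
      ≤ Real.sqrt (normSq (xh - yh)) := by
    have hterm : ∀ i, |lengthSqDist x i - lengthSqDist y i| = |(xh - yh) i| * |(xh + yh) i| := by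
      intro i
      rw [← normalize_sq_eq_lengthSqDist x i, ← normalize_sq_eq_lengthSqDist y i, ← abs_mul]
      congr 1
      simp only [hxh, hyh, Pi.sub_apply, Pi.add_apply]
      ring
    simp only [hterm]
    have hcs := sum_abs_mul_abs_le (xh - yh) (xh + yh)
    have hplus : Real.sqrt (normSq (xh + yh)) ≤ 2 := by
      have := sqrt_normSq_add_le xh yh
      linarith
    have hnn : 0 ≤ Real.sqrt (normSq (xh - yh)) := Real.sqrt_nonneg _
    nlinarith
  -- x̂ − ŷ = (1/a) • (x − y − (a − b) • ŷ)
  have hid : xh - yh = (1 / a) • (x - y - (a - b) • yh) := by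
    funext i
    simp only [hxh, hyh, Pi.smul_apply, Pi.sub_apply, smul_eq_mul]
    field_simp
    ring
  have step2 : Real.sqrt (normSq (xh - yh)) ≤ (1 / a) * (ε + ε) := by
    rw [hid, sqrt_normSq_smul, abs_of_pos (by positivity)]
    refine mul_le_mul_of_nonneg_left ?_ (by positivity)
    calc Real.sqrt (normSq (x - y - (a - b) • yh))
        ≤ Real.sqrt (normSq (x - y)) + Real.sqrt (normSq ((a - b) • yh)) := sqrt_normSq_sub_le _ _
      _ = Real.sqrt (normSq (x - y)) + |a - b| := by rw [sqrt_normSq_smul, hyh1, mul_one]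
      _ ≤ ε + ε := add_le_add hε ((abs_sqrt_normSq_sub_le x y).trans hε)
  calc (1 / 2) * ∑ i, |lengthSqDist x i - lengthSqDist y i| ≤ Real.sqrt (normSq (xh - yh)) := step1
    _ ≤ (1 / a) * (ε + ε) := step2
    _ = 2 * ε / a := by ring

end vectorSamplingTV

end SampleQuery

end Literature.Computability.QuantumComplexity

end
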